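import Summits.BirchSwinnertonDyer.BirchSwinnertonDyer.Theorems.ErratumRoadFiveSelfDualMemberInputs
import Summits.BirchSwinnertonDyer.BirchSwinnertonDyer.Theorems.ErratumRoadFiveIMCDivMemberCongruenceErratumTame
import HarnessLib

/-!
# Road FF at the SELF-DUAL member module: the member congruence `e_m` at the erratum data for `A^†_{g_m}|_{Γ_K}`
# (`XBig κ (D.Δ.selfDualCofreeRepOver K) 𝔮 Σ ⧸ p^m ≃ (𝒪_m⟦T⟧ ⊗_Λ X^Σ(E/K_∞)) ⧸ p^m`)

Cell `bsd-stepL`, seat `bsd-stepL-imc-p1` g24 — TWIST AUDIT of crux `ErratumThm23SigmaLe` (item stmt-BirchSwinnertonDyer-25505), repair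
step (R4) part 2 (memo `HOME/imc-p1/g24/TWIST-AUDIT-25505-imc-p1-g24.md`): the two assembly theorems of
`ErratumRoadFiveIMCDivMemberCongruenceErratumTame` (imc-p1 g10) re-run with `ρg := D.Δ.selfDualCofreeRepOver K` — the erratum's own
`A_{g_m}` (§2 p. 2: the self-dual Tate twist) — for a Hida member of weight `k_m ≡ 2 (mod 2(p−1)p^{m−1})`, feeding the generic
`RoadFFMember.nonempty_memberCongruence` with the self-dual inputs of `ErratumRoadFiveSelfDualMemberInputs` ((b†) over `Γ_K`, `hdiv`,
`hglob`, `hloc`). Everything on the `E`-side is unchanged. Theorems only (0 def ∕ 0 fact ∕ 0 sorry); helper for Road FF† (crux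
`IMCDivAtErratumDataAllR`, item stmt-BirchSwinnertonDyer-20169) once crux 25505 is re-keyed to the self-dual module.

[cite: Castella2018Erratum, §2 (p. 2), Lemma 2.1, proof of Thm. 1.1 (a)(b) (p. 4)] [cite: Skinner2016PacificMC, §2.6 (2-6-1), §3.1 (b)]
-/

set_option autoImplicit false

noncomputable section

-- D-0017: single-problem summit, the namespace repeats the problem name by design.
set_option linter.dupNamespace false

open scoped TensorProduct Classical

open CategoryTheory PowerSeries NumberField IsDedekindDomain Field WeierstrassCurve
open Literature.NumberTheory.GaloisRepresentations Literature.NumberTheory.EllipticCurves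
  Literature.NumberTheory.EllipticCurves.BigGaloisRep Literature.NumberTheory.EllipticCurves.GreenbergSelmer
  Literature.NumberTheory.EllipticCurves.Skinner2016 Literature.NumberTheory.EllipticCurves.Rank1Residual
  Literature.NumberTheory.EllipticCurves.Rank1Residual.Typed Literature.NumberTheory.EllipticCurves.ModularForms
  Literature.NumberTheory.EllipticCurves.Castella2018
open Summit.BirchSwinnertonDyer.Rank1Residual.X11b.Halves Summit.BirchSwinnertonDyer.Rank1Residual.X11b.AcSelmer
open Summit.BirchSwinnertonDyer.Rank1Residual.X11b Summit.BirchSwinnertonDyer.Rank1Residual.X11b.RoadFFMember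

namespace Summit.BirchSwinnertonDyer.BirchSwinnertonDyer.Theorems.SelfDualTwist

section Erratum

variable {W : WeierstrassCurve ℚ} [W.IsElliptic] [W.IsGloballyMinimal] {p : ℕ} [Fact p.Prime] {m : ℕ}
  {K : Type} [Field K] [NumberField K]

/-- **THE MEMBER CONGRUENCE `e_m` AT THE ERRATUM DATA FOR THE SELF-DUAL MODULE `A^†_{g_m}`** (tame-level `Σ`-hypothesis, Frobenius
data explicit). BYTE-TWIN of `RoadFFMember.nonempty_memberCongruence_erratum_tame` with the member module replaced by the erratum's own
self-dual Tate twist `D.Δ.selfDualCofreeRepOver K` (`OrdinaryNewformDatumSelfDualTwist`) and the extra weight binder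
`2(p−1)p^{m−1} ∣ k_m − 2` (so that (b) transports to the self-dual lattice, `SelfDualTwist.exists_torsionCongruence_baseChange_selfDual`):
`((𝒪_m⟦T⟧ ⊗_Λ X^Σ_𝔮(E/K_∞)) ⧸ (p^m)) ≃ₗ[𝒪_m⟦T⟧] (XBig κ (A^†_{g_m}|_{Γ_K}) 𝔮 Σ ⧸ (p^m))`. CONDITIONAL on the displayed (F1) named facts
`hSh`, `hSig`, on (SelBC) `hSelBC` and on (Frob) `t₀, b, b', hfb, hfb'`. Nothing is booked.
[cite: Castella2018Erratum, §2 (p. 2, the self-dual Tate twist), Thm. 1.1, (b), Lemma 2.1 and proof of Thm. 1.1 (pp. 1–4)]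
[cite: Skinner2016PacificMC, §2.6 (2-6-1), §3.1 (b)(d)] [cite: SkinnerUrban2014, Prop. 3.2.3] -/
theorem nonempty_memberCongruence_erratum_tame_selfDual (hSh : SkinnerUrban2014.prop323_XAc_equiv_XBigDecomp)
    (hSig : selmerBig_eq_selmerBigDecomp_of_unramifiedOutside)
    (hp : 5 ≤ p) (hirr : Irr W p) (hK : IsImaginaryQuadratic K) (hsplit : SatisfiesHeegnerHypothesis p K)
    (𝔮 : HeightOneSpectrum (𝓞 K)) (h𝔮 : ((p : ℕ) : 𝓞 K) ∈ 𝔮.asIdeal) (φ : 𝔮.adicCompletion K →+* ℚ_[p])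
    (hiv : ∀ Q : (W.baseChange ℚ_[p]).toAffine.Point, p • Q = 0 → Q = 0)
    (S : Set (HeightOneSpectrum (𝓞 K))) (hSfin : S.Finite) (hSp : ∀ w ∈ S, ((p : ℕ) : 𝓞 K) ∉ w.asIdeal)
    (hS : ∀ w : HeightOneSpectrum (𝓞 K), w ∉ S → ((p : ℕ) : 𝓞 K) ∉ w.asIdeal →
      (W.baseChange K).HasGoodReductionAt w)
    (hSM : ∀ w : HeightOneSpectrum (𝓞 K), w ∉ S → ((W.conductorNorm ℤ / p : ℕ) : 𝓞 K) ∉ w.asIdeal)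
    (κ : ZpExtension K p) (hκ : κ.IsAnticyclotomic) (γ : absoluteGaloisGroup K) [Fact (κ.IsTopGenerator γ)]
    (D : HidaCongruentMember W p m) (hm : 1 ≤ m)
    (hk : (2 * ((p : ℤ) - 1) * (p : ℤ) ^ (m - 1)) ∣ D.k - 2)
    [TopologicalSpace (IwasawaAlgebra p)]
    [ContinuousSMul (IwasawaAlgebra p) (BigRepModule ℤ_[p] p (PrimaryTorsion (geomPoints (W.baseChange K)) p))]
    [TopologicalSpace (PowerSeries (padicCoeffIntegers D.ι))]
    [ContinuousSMul (PowerSeries (padicCoeffIntegers D.ι)) (BigRepModule (padicCoeffIntegers D.ι) p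
      (CoeffExtension ℤ_[p] (padicCoeffIntegers D.ι) (PrimaryTorsion (geomPoints (W.baseChange K)) p)))]
    [ContinuousSMul (PowerSeries (padicCoeffIntegers D.ι)) (BigRepModule (padicCoeffIntegers D.ι) p
      (Cofree D.Δ.selfDualRep (padicCoeffField D.ι)))]
    (hSelBC : Nonempty (selmerBig κ (ContinuousRep.extendScalars (R := ℤ_[p]) (G := absoluteGaloisGroup K)
        (A := PrimaryTorsion (geomPoints (W.baseChange K)) p) (padicCoeffIntegers D.ι)
        ((W.baseChange K).primaryTorsionGaloisRep p)) 𝔮 S ≃ₗ[PowerSeries (padicCoeffIntegers D.ι)]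
      PowerSeries (padicCoeffIntegers D.ι) ⊗[IwasawaAlgebra p]
        selmerBig κ ((W.baseChange K).primaryTorsionGaloisRep p) 𝔮 S))
    {ι' : Type*} [Fintype ι'] (t₀ : padicCoeffIntegers D.ι →ₗ[ℤ_[p]] ℤ_[p]) (b b' : ι' → padicCoeffIntegers D.ι)
    (hfb : ∀ a : padicCoeffIntegers D.ι, a = ∑ i, t₀ (a * b' i) • b i)
    (hfb' : ∀ a : padicCoeffIntegers D.ι, a = ∑ i, t₀ (a * b i) • b' i) :
    Nonempty ((((PowerSeries (padicCoeffIntegers D.ι)) ⊗[IwasawaAlgebra p]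
          Summit.BirchSwinnertonDyer.Rank1Residual.X11b.AcSelmer.XAc (W.baseChange K) p κ 𝔮 S γ) ⧸
        (((Ideal.span {(C (p : ℤ_[p]) : IwasawaAlgebra p)}).map
            (algebraMap (IwasawaAlgebra p) (PowerSeries (padicCoeffIntegers D.ι)))) ^ m •
          (⊤ : Submodule (PowerSeries (padicCoeffIntegers D.ι))
            ((PowerSeries (padicCoeffIntegers D.ι)) ⊗[IwasawaAlgebra p] Summit.BirchSwinnertonDyer.Rank1Residual.X11b.AcSelmer.XAc (W.baseChange K) p κ 𝔮 S γ))))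
        ≃ₗ[PowerSeries (padicCoeffIntegers D.ι)]
      (XBig κ (D.Δ.selfDualCofreeRepOver K) 𝔮 S ⧸
        (((Ideal.span {(C (p : ℤ_[p]) : IwasawaAlgebra p)}).map
            (algebraMap (IwasawaAlgebra p) (PowerSeries (padicCoeffIntegers D.ι)))) ^ m •
          (⊤ : Submodule (PowerSeries (padicCoeffIntegers D.ι)) (XBig κ (D.Δ.selfDualCofreeRepOver K) 𝔮 S))))) := by
  haveI : Module.Free ℤ_[p] (padicCoeffIntegers D.ι) := moduleFree_of_frobData D.ι t₀ b b' hfb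
  -- (unr): inertia at every `w ∉ Σ`, `w ∤ p` acts trivially on `E_K[p^∞]` (good reduction there; Néron–Ogg–Shafarevich)
  have hunr : ∀ w : HeightOneSpectrum (𝓞 K), w ∉ S → ((p : ℕ) : 𝓞 K) ∉ w.asIdeal →
      ∀ σ : absoluteGaloisGroup (w.adicCompletion K), σ ∈ absInertia (w.adicCompletion K) →
        ∀ P : PrimaryTorsion (geomPoints (W.baseChange K)) p,
          absGaloisRestrict K (w.adicCompletion K) σ • P = P :=
    fun w hw hpw σ hσ P =>
      BigRep.smul_primaryTorsion_eq_of_mem_absInertia_of_hasGoodReductionAt (W.baseChange K) p (hS w hw hpw)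
        hpw hσ P
  -- (F1)
  have hF1 := nonempty_XAc_equiv_XBig W p K hSh hSig hp hirr hK hsplit 𝔮 h𝔮 S hSfin hSp
    (fun w hw hpw σ P => by
      obtain ⟨σ, hσ⟩ := σ
      rw [WeierstrassCurve.primaryTorsionGaloisRep_apply]
      exact hunr w hw hpw σ hσ P)
    κ hκ γ
  exact nonempty_memberCongruence κ m ((W.baseChange K).primaryTorsionGaloisRep p)
    (ContinuousRep.extendScalars (R := ℤ_[p]) (G := absoluteGaloisGroup K)
      (A := PrimaryTorsion (geomPoints (W.baseChange K)) p) (padicCoeffIntegers D.ι)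
      ((W.baseChange K).primaryTorsionGaloisRep p))
    (D.Δ.selfDualCofreeRepOver K) 𝔮 S hF1 hSelBC t₀ b b' hfb hfb'
    (SelfDualTwist.exists_torsionCongruence_baseChange_selfDual D K hm hk)
    (hdiv_extendScalars_erratum K (padicCoeffIntegers D.ι) (W := W))
    (hglob_extendScalars_erratum K (padicCoeffIntegers D.ι) κ hK hirr m hm)
    (hloc_extendScalars (padicCoeffIntegers D.ι) (W.baseChange K) κ 𝔮 S (geomPoints_baseChange_divisible K (W := W))
      (BigRep.hdec_geomPoints_of_padicTorsion W p K 𝔮 φ hiv) hunr m hm)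
    (SelfDualTwist.hdiv_selfDual D.Δ)
    (SelfDualTwist.hglob_selfDual_erratum D K hm hk κ hK hirr m hm)
    (SelfDualTwist.hloc_selfDual D K hm hk κ 𝔮 S (BigRep.hdec_geomPoints_of_padicTorsion W p K 𝔮 φ hiv) hSM m hm)

/-- **`e_m` for the SELF-DUAL member module from the NAMED FACTS (SelBC) and (F1), with (Frob), `Module.Free/Finite ℤ_p 𝒪_m`
discharged** (`HidaCongruentForm.exists_frobeniusData`, `moduleFree_coeffRing`, `moduleFinite_coeffRing`; needs `N/p ≠ 0`). Same
conclusion as `nonempty_memberCongruence_erratum_tame_selfDual`; byte-twin of `RoadFFMember.nonempty_memberCongruence_erratum_of_facts`.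
CONDITIONAL on the three named facts; nothing booked. [cite: Castella2018Erratum, §2 (p. 2), (b), Lemma 2.1 and proof of Thm. 1.1 (p. 4)]
[cite: Skinner2016PacificMC, §2.3 (p. 179), §2.6 (2-6-1)] [cite: SkinnerUrban2014, Prop. 3.2.3] -/
theorem nonempty_memberCongruence_erratum_of_facts_selfDual (hSh : SkinnerUrban2014.prop323_XAc_equiv_XBigDecomp)
    (hSig : selmerBig_eq_selmerBigDecomp_of_unramifiedOutside)
    (hSelBC : Skinner2016.selmerBig_extendScalars_equiv_baseChange)
    (hp : 5 ≤ p) (hirr : Irr W p) (hK : IsImaginaryQuadratic K) (hsplit : SatisfiesHeegnerHypothesis p K)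
    (𝔮 : HeightOneSpectrum (𝓞 K)) (h𝔮 : ((p : ℕ) : 𝓞 K) ∈ 𝔮.asIdeal) (φ : 𝔮.adicCompletion K →+* ℚ_[p])
    (hiv : ∀ Q : (W.baseChange ℚ_[p]).toAffine.Point, p • Q = 0 → Q = 0)
    (S : Set (HeightOneSpectrum (𝓞 K))) (hSfin : S.Finite) (hSp : ∀ w ∈ S, ((p : ℕ) : 𝓞 K) ∉ w.asIdeal)
    (hS : ∀ w : HeightOneSpectrum (𝓞 K), w ∉ S → ((p : ℕ) : 𝓞 K) ∉ w.asIdeal →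
      (W.baseChange K).HasGoodReductionAt w)
    (hSM : ∀ w : HeightOneSpectrum (𝓞 K), w ∉ S → ((W.conductorNorm ℤ / p : ℕ) : 𝓞 K) ∉ w.asIdeal)
    (κ : ZpExtension K p) (hκ : κ.IsAnticyclotomic) (γ : absoluteGaloisGroup K) [Fact (κ.IsTopGenerator γ)]
    (D : HidaCongruentMember W p m) (hm : 1 ≤ m)
    (hk : (2 * ((p : ℤ) - 1) * (p : ℤ) ^ (m - 1)) ∣ D.k - 2) [NeZero (W.conductorNorm ℤ / p)]
    [TopologicalSpace (IwasawaAlgebra p)]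
    [ContinuousSMul (IwasawaAlgebra p) (BigRepModule ℤ_[p] p (PrimaryTorsion (geomPoints (W.baseChange K)) p))]
    [TopologicalSpace (PowerSeries (padicCoeffIntegers D.ι))]
    [ContinuousSMul (PowerSeries (padicCoeffIntegers D.ι)) (BigRepModule (padicCoeffIntegers D.ι) p
      (CoeffExtension ℤ_[p] (padicCoeffIntegers D.ι) (PrimaryTorsion (geomPoints (W.baseChange K)) p)))]
    [ContinuousSMul (PowerSeries (padicCoeffIntegers D.ι)) (BigRepModule (padicCoeffIntegers D.ι) p
      (Cofree D.Δ.selfDualRep (padicCoeffField D.ι)))] :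
    Nonempty ((((PowerSeries (padicCoeffIntegers D.ι)) ⊗[IwasawaAlgebra p]
          Summit.BirchSwinnertonDyer.Rank1Residual.X11b.AcSelmer.XAc (W.baseChange K) p κ 𝔮 S γ) ⧸
        (((Ideal.span {(C (p : ℤ_[p]) : IwasawaAlgebra p)}).map
            (algebraMap (IwasawaAlgebra p) (PowerSeries (padicCoeffIntegers D.ι)))) ^ m •
          (⊤ : Submodule (PowerSeries (padicCoeffIntegers D.ι))
            ((PowerSeries (padicCoeffIntegers D.ι)) ⊗[IwasawaAlgebra p] Summit.BirchSwinnertonDyer.Rank1Residual.X11b.AcSelmer.XAc (W.baseChange K) p κ 𝔮 S γ))))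
        ≃ₗ[PowerSeries (padicCoeffIntegers D.ι)]
      (XBig κ (D.Δ.selfDualCofreeRepOver K) 𝔮 S ⧸
        (((Ideal.span {(C (p : ℤ_[p]) : IwasawaAlgebra p)}).map
            (algebraMap (IwasawaAlgebra p) (PowerSeries (padicCoeffIntegers D.ι)))) ^ m •
          (⊤ : Submodule (PowerSeries (padicCoeffIntegers D.ι)) (XBig κ (D.Δ.selfDualCofreeRepOver K) 𝔮 S))))) :=
  haveI : Module.Free ℤ_[p] (padicCoeffIntegers D.ι) := D.moduleFree_coeffRing
  haveI : Module.Finite ℤ_[p] (padicCoeffIntegers D.ι) := D.moduleFinite_coeffRing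
  D.exists_frobeniusData.elim fun _n h => h.elim fun t₀ h => h.elim fun b h => h.elim fun b' h =>
    nonempty_memberCongruence_erratum_tame_selfDual hSh hSig hp hirr hK hsplit 𝔮 h𝔮 φ hiv S hSfin hSp hS hSM κ hκ γ D hm hk
      (Skinner2016.nonempty_selmerBig_primaryTorsion_extendScalars_equiv W κ (padicCoeffIntegers D.ι) 𝔮 S hSelBC)
      t₀ b b' h.1 h.2

end Erratum

end Summit.BirchSwinnertonDyer.BirchSwinnertonDyer.Theorems.SelfDualTwist

end
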